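import Summits.Ventures.Crystal3D.Theorems.StickyWulffConstantGenericWallFloorStarLemma
import Summits.Ventures.Crystal3D.Theorems.StickyWulffConstantNoReconstructionGainCubicActions
import Summits.Ventures.Crystal3D.Theorems.StickyWulffConstantGenericWallFloorGrainCredits
import HarnessLib

/-!
# Skew roots of a translation offset, II: root slots of rise `≥ ½` (case B) and the lattice frame of a
# `{111}` plane (case C)

HONEST FRAMING. Part of the venture `Summits/Ventures/Crystal3D` (cell `crystal3d-full`), helper
`--supports` the crux `CoaxialWallLaw` (stmt-Ventures-19481, `route-Ventures-StickyWulffConstant`),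
REGISTERED line `WallLedgerF` (planner cf-p1 gen 16), open stub `stub_coaxialTwoSlabAdhesion`.
RUNG CREDIT ONLY — pure lattice geometry, nothing about packings.  Companion of
`…CoaxialWallLawSkewArithmetic` (the real trichotomy (A)/(B)/(C) of the skew pattern of an offset `τ`,
`p = √2 · cubicCoords τ`):

* (B) `exists_skewRoot_of_axis` — if all four `p_k ± p_i` (`i ≠ k`) are non-integers then for EVERY orientation
  `A` some slot `w` with a τ-skew orthogonal slot `s` (`2⟪τ, s⟫ ∉ ℤ`) has rise `(A w)₂ ≥ ½`
  (the `k`-th row of the orthogonal cubic matrix of `A⁻¹` has `|v_k| + max_{i ≠ k} |v_i| ≥ 1/√2`);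
* (C) `exists_skewFrame_of_cube` — if the three numbers `εᵢ pᵢ + εⱼ pⱼ` of a sign vector `ε = cubeInt c` are
  non-integers then the lattice has a symmetry `G` (`G·Λ₀ = Λ₀`: the identity or the bond mirror of slot
  `8`, `2` or `6`, `cubeInt_frame_table`) carrying the basal axis `e₃` to `±ε/√3`, and in the frame
  `L' = A₁ ∘ G` of the SAME lattice every slot off the `L' e₃`-plane is τ-skew — the hypothesis `hskew` of
  19481-p2's `coaxialTwoSlabAdhesion_general_trans_net`.

Tables over `Fin 12`/`Fin 8` (`slotInt`, `cubeInt` of `…CutNormals`) are kernel-decided.  Consumed by the union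
theorem `…CoaxialWallLawPosCharge`.  WHAT THIS IS NOT: anything about walls or packings; F-C1 not moved.
-/

noncomputable section

namespace Summit.Ventures.Crystal3D.Theorems

open Summit.Ventures.Crystal3D Finset Matrix NearIdentity
open Literature.MathematicalPhysics.StatisticalMechanics (barlowPos barlowStacking fccStacking
  constHagg IsHaggSeq barlowPos_mem)
open scoped InnerProductSpace

/-! ### 1. The slot dictionary: cubic tables (kernel-decided) -/

/-- Table: a slot with a non-zero `k`-th cubic coordinate is `±e_k ± e_i` for one `i ≠ k`. -/
theorem slotInt_axis_shape : ∀ k : Fin 3, ∀ m : Fin 12, slotInt m k ≠ 0 →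
    ∃ i : Fin 3, i ≠ k ∧ (slotInt m k = 1 ∨ slotInt m k = -1) ∧ (slotInt m i = 1 ∨ slotInt m i = -1) ∧
      ∀ j : Fin 3, j ≠ k → j ≠ i → slotInt m j = 0 := by
  decide

/-- Table: every sign pattern on two cubic axes is a slot. -/
theorem slotInt_of_signs : ∀ k i : Fin 3, k ≠ i → ∀ bk bi : Bool, ∃ m : Fin 12,
    slotInt m k = (if bk then 1 else -1) ∧ slotInt m i = (if bi then 1 else -1) ∧
      ∀ j : Fin 3, j ≠ k → j ≠ i → slotInt m j = 0 := by
  decide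

/-- Table: every slot has an ORTHOGONAL slot with the same cubic support. -/
theorem slotInt_partner : ∀ m : Fin 12, ∃ m' : Fin 12, slotInt m ⬝ᵥ slotInt m' = 0 ∧
    ∀ k : Fin 3, slotInt m k ≠ 0 → slotInt m' k ≠ 0 := by
  decide

/-- Table: a slot off the `{111}` plane with cubic normal `cubeInt c` is `±(ε_k e_k + ε_i e_i)`. -/
theorem slotInt_offPlane_shape : ∀ c : Fin 8, ∀ m : Fin 12, cubeInt c ⬝ᵥ slotInt m ≠ 0 →
    ∃ k i : Fin 3, k ≠ i ∧
      ((slotInt m k = cubeInt c k ∧ slotInt m i = cubeInt c i) ∨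
        (slotInt m k = -cubeInt c k ∧ slotInt m i = -cubeInt c i)) ∧
      ∀ j : Fin 3, j ≠ k → j ≠ i → slotInt m j = 0 := by
  decide

/-- The cube vertices have coordinates `±1`. -/
theorem cubeInt_pm_one : ∀ c : Fin 8, ∀ i : Fin 3, cubeInt c i = 1 ∨ cubeInt c i = -1 := by
  decide

/-- Every real sign vector is a cube vertex. -/
theorem exists_cubeInt_eq (ε₀ ε₁ ε₂ : ℝ) (h₀ : ε₀ = 1 ∨ ε₀ = -1) (h₁ : ε₁ = 1 ∨ ε₁ = -1)
    (h₂ : ε₂ = 1 ∨ ε₂ = -1) :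
    ∃ c : Fin 8, (cubeInt c 0 : ℝ) = ε₀ ∧ (cubeInt c 1 : ℝ) = ε₁ ∧ (cubeInt c 2 : ℝ) = ε₂ := by
  rcases h₀ with rfl | rfl <;> rcases h₁ with rfl | rfl <;> rcases h₂ with rfl | rfl
  · exact ⟨0, by simp [cubeInt]⟩
  · exact ⟨1, by simp [cubeInt]⟩
  · exact ⟨2, by simp [cubeInt]⟩
  · exact ⟨3, by simp [cubeInt]⟩
  · exact ⟨4, by simp [cubeInt]⟩
  · exact ⟨5, by simp [cubeInt]⟩
  · exact ⟨6, by simp [cubeInt]⟩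
  · exact ⟨7, by simp [cubeInt]⟩

/-! ### 2. The slot dictionary: metric identities -/

/-- **Twice the offset pairing of a slot in cubic coordinates:**
`2 ⟪τ, slot m⟫ = Σᵢ slotInt m i · (√2 · cubicCoords τ i)`. -/
theorem two_inner_slotSite (τ : EuclideanSpace ℝ (Fin 3)) (m : Fin 12) :
    2 * ⟪τ, slotSite m⟫_ℝ = ∑ i, (slotInt m i : ℝ) * (Real.sqrt 2 * cubicCoords τ i) := by
  have hs : Real.sqrt 2 ^ 2 = 2 := Real.sq_sqrt (by norm_num)
  have hs0 : Real.sqrt 2 ≠ 0 := by positivity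
  rw [inner_eq_cubicCoords, cubicCoords_slotSite]
  simp only [dotProduct, slotVec, Finset.mul_sum]
  refine Finset.sum_congr rfl fun i _ => ?_
  field_simp
  rw [hs]; ring

/-- **The rise of a slot in cubic coordinates:** `(A (slot m))₂ = slotVec m ⬝ cubicCoords (A⁻¹ e₃)`. -/
theorem apply_two_slotSite (A : EuclideanSpace ℝ (Fin 3) ≃ₗᵢ[ℝ] EuclideanSpace ℝ (Fin 3)) (m : Fin 12) :
    (A (slotSite m)) 2 = slotVec m ⬝ᵥ cubicCoords (A.symm (EuclideanSpace.single (2 : Fin 3) (1 : ℝ))) := by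
  rw [apply_two_eq_inner_e₃]
  conv_lhs => rw [← A.apply_symm_apply (EuclideanSpace.single (2 : Fin 3) (1 : ℝ))]
  rw [A.inner_map_map, inner_eq_cubicCoords, cubicCoords_slotSite]

/-- The cubic coordinates of `A⁻¹ e₃` form a unit vector. -/
theorem sum_sq_cubicCoords_symm_e₃ (A : EuclideanSpace ℝ (Fin 3) ≃ₗᵢ[ℝ] EuclideanSpace ℝ (Fin 3)) :
    cubicCoords (A.symm (EuclideanSpace.single (2 : Fin 3) (1 : ℝ))) 0 ^ 2 +
      cubicCoords (A.symm (EuclideanSpace.single (2 : Fin 3) (1 : ℝ))) 1 ^ 2 +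
      cubicCoords (A.symm (EuclideanSpace.single (2 : Fin 3) (1 : ℝ))) 2 ^ 2 = 1 := by
  have h := norm_sq_eq_cubicCoords (A.symm (EuclideanSpace.single (2 : Fin 3) (1 : ℝ)))
  rw [LinearIsometryEquiv.norm_map, PiLp.norm_single, norm_one, one_pow] at h
  simp only [dotProduct, Fin.sum_univ_three] at h
  nlinarith [h]

/-- A sum over `Fin 3` supported on two indices. -/
theorem sum_fin_three_of_support (f : Fin 3 → ℝ) (k i : Fin 3) (hki : k ≠ i)
    (h0 : ∀ j : Fin 3, j ≠ k → j ≠ i → f j = 0) : ∑ j, f j = f k + f i := by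
  rw [Fintype.sum_eq_add k i hki]
  intro j hj
  exact h0 j hj.1 hj.2

/-- Re-indexing a three-term sum by a permutation of `Fin 3`. -/
theorem sum_three_perm (f : Fin 3 → ℝ) : ∀ k i l : Fin 3, i ≠ k → l ≠ k → i ≠ l →
    f 0 + f 1 + f 2 = f k + f i + f l := by
  intro k i l
  fin_cases k <;> fin_cases i <;> fin_cases l <;> intro h1 h2 h3 <;>
    simp only [Fin.isValue, Fin.zero_eta, Fin.mk_one, Fin.reduceFinMk, ne_eq, not_true_eq_false,
      one_ne_zero, zero_ne_one] at h1 h2 h3 ⊢ <;>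
    first | exact absurd rfl h1 | exact absurd rfl h2 | exact absurd rfl h3 | ring

/-! ### 3. Case (B): a skew root of rise `≥ ½` for every orientation -/

/-- `x² + y² + z² = 1`, `|z| ≤ |y|` ⇒ `(|x| + |y|)/√2 ≥ ½`. -/
theorem half_le_abs_add_abs_div_sqrt_two {x y z : ℝ} (h : x ^ 2 + y ^ 2 + z ^ 2 = 1) (hyz : |z| ≤ |y|) :
    1 / 2 ≤ (|x| + |y|) / Real.sqrt 2 := by
  have hs : Real.sqrt 2 ^ 2 = 2 := Real.sq_sqrt (by norm_num)
  have hs0 : 0 < Real.sqrt 2 := by positivity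
  rw [le_div_iff₀ hs0]
  have hx := abs_nonneg x
  have hy := abs_nonneg y
  have hz2 : z ^ 2 ≤ y ^ 2 := by
    rw [← sq_abs z, ← sq_abs y]; exact pow_le_pow_left₀ (abs_nonneg z) hyz 2
  have hx2 : |x| ^ 2 = x ^ 2 := sq_abs x
  have hy2 : |y| ^ 2 = y ^ 2 := sq_abs y
  nlinarith [hs, hx, hy, hz2, hx2, hy2, sq_nonneg (|x| + |y| - Real.sqrt 2 / 2), Real.sqrt_nonneg 2]

/-- **Case (B), the skew side.**  If all four `p_k ± p_i` (`i ≠ k`) are non-integers, where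
`p = √2 · cubicCoords τ`, then every slot with a non-zero `k`-th cubic coordinate is skew for `τ`. -/
theorem skew_of_axis (τ : EuclideanSpace ℝ (Fin 3)) (k : Fin 3)
    (hk : ∀ i : Fin 3, i ≠ k →
      (¬ ∃ z : ℤ, Real.sqrt 2 * cubicCoords τ k + Real.sqrt 2 * cubicCoords τ i = z) ∧
      (¬ ∃ z : ℤ, Real.sqrt 2 * cubicCoords τ k - Real.sqrt 2 * cubicCoords τ i = z))
    (m : Fin 12) (hm : slotInt m k ≠ 0) : ∀ z : ℤ, ⟪τ, slotSite m⟫_ℝ ≠ (z : ℝ) / 2 := by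
  intro z hz
  obtain ⟨i, hik, hsk, hsi, h0⟩ := slotInt_axis_shape k m hm
  have h2 : ∑ j, (slotInt m j : ℝ) * (Real.sqrt 2 * cubicCoords τ j) = z := by
    rw [← two_inner_slotSite, hz]; ring
  rw [sum_fin_three_of_support _ k i (Ne.symm hik) (fun j hj hj' => by rw [h0 j hj hj']; simp)] at h2
  obtain ⟨hP, hM⟩ := hk i hik
  rcases hsk with e | e <;> rcases hsi with e' | e' <;> rw [e, e'] at h2 <;> push_cast at h2
  · exact hP ⟨z, by linarith⟩
  · exact hM ⟨z, by linarith⟩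
  · exact hM ⟨-z, by push_cast; linarith⟩
  · exact hP ⟨-z, by push_cast; linarith⟩

/-- **Case (B), the rise side.**  For every orientation `A` and axis `k` some slot with a non-zero
`k`-th cubic coordinate has rise `(A w)₂ ≥ ½`. -/
theorem exists_axisSlot_rise (A : EuclideanSpace ℝ (Fin 3) ≃ₗᵢ[ℝ] EuclideanSpace ℝ (Fin 3)) (k : Fin 3) :
    ∃ m : Fin 12, slotInt m k ≠ 0 ∧ 1 / 2 ≤ (A (slotSite m)) 2 := by
  have hv1 := sum_sq_cubicCoords_symm_e₃ A
  set v := cubicCoords (A.symm (EuclideanSpace.single (2 : Fin 3) (1 : ℝ))) with hv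
  -- the other two axes, the larger coordinate first
  obtain ⟨i, l, hik, hlk, hil⟩ := (by decide : ∀ k : Fin 3, ∃ i l : Fin 3, i ≠ k ∧ l ≠ k ∧ i ≠ l) k
  have hsq : v k ^ 2 + v i ^ 2 + v l ^ 2 = 1 := by
    rw [← sum_three_perm (fun j => v j ^ 2) k i l hik hlk hil]; exact hv1
  -- WLOG `|v l| ≤ |v i|`
  obtain ⟨i, hik, hrise⟩ : ∃ i : Fin 3, i ≠ k ∧ 1 / 2 ≤ (|v k| + |v i|) / Real.sqrt 2 := by
    rcases le_total |v l| |v i| with h | h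
    · exact ⟨i, hik, half_le_abs_add_abs_div_sqrt_two hsq h⟩
    · exact ⟨l, hlk, half_le_abs_add_abs_div_sqrt_two (by linarith [hsq]) h⟩
  -- the slot with the signs of `v k`, `v i`
  obtain ⟨m, hmk, hmi, hm0⟩ := slotInt_of_signs k i (Ne.symm hik) (decide (0 ≤ v k)) (decide (0 ≤ v i))
  refine ⟨m, by rw [hmk]; split_ifs <;> decide, ?_⟩
  rw [apply_two_slotSite, ← hv]
  have hsum : slotVec m ⬝ᵥ v = ((slotInt m k : ℝ) * v k + (slotInt m i : ℝ) * v i) / Real.sqrt 2 := by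
    simp only [dotProduct, slotVec]
    rw [sum_fin_three_of_support _ k i (Ne.symm hik) (fun j hj hj' => by rw [hm0 j hj hj']; simp)]
    ring
  rw [hsum]
  have ek : (slotInt m k : ℝ) * v k = |v k| := by
    by_cases h : 0 ≤ v k
    · rw [hmk, if_pos (decide_eq_true h), abs_of_nonneg h]; simp
    · rw [hmk, if_neg (by simpa using h), abs_of_neg (lt_of_not_ge h)]; simp
  have ei : (slotInt m i : ℝ) * v i = |v i| := by
    by_cases h : 0 ≤ v i
    · rw [hmi, if_pos (decide_eq_true h), abs_of_nonneg h]; simp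
    · rw [hmi, if_neg (by simpa using h), abs_of_neg (lt_of_not_ge h)]; simp
  rw [ek, ei]; exact hrise

/-- **Case (B).**  If all four `p_k ± p_i` (`i ≠ k`) are non-integers (`p = √2 · cubicCoords τ`), then for
every orientation `A` there is a slot `w` with a τ-skew orthogonal slot `s` and rise `(A w)₂ ≥ ½`. -/
theorem exists_skewRoot_of_axis (τ : EuclideanSpace ℝ (Fin 3)) (k : Fin 3)
    (hk : ∀ i : Fin 3, i ≠ k →
      (¬ ∃ z : ℤ, Real.sqrt 2 * cubicCoords τ k + Real.sqrt 2 * cubicCoords τ i = z) ∧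
      (¬ ∃ z : ℤ, Real.sqrt 2 * cubicCoords τ k - Real.sqrt 2 * cubicCoords τ i = z))
    (A : EuclideanSpace ℝ (Fin 3) ≃ₗᵢ[ℝ] EuclideanSpace ℝ (Fin 3)) :
    ∃ w ∈ fccSlots, ∃ s ∈ fccSlots, ⟪w, s⟫_ℝ = 0 ∧ (∀ z : ℤ, ⟪τ, s⟫_ℝ ≠ (z : ℝ) / 2) ∧
      1 / 2 ≤ (A w) 2 := by
  obtain ⟨m, hmk, hrise⟩ := exists_axisSlot_rise A k
  obtain ⟨m', hmm', hsupp⟩ := slotInt_partner m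
  refine ⟨slotSite m, slotSite_mem m, slotSite m', slotSite_mem m', ?_,
    skew_of_axis τ k hk m' (hsupp k hmk), hrise⟩
  rw [inner_slotSite, hmm']; simp

/-! ### 4. Case (C): the `{111}` plane of a cube vertex and its lattice frame -/

/-- **Case (C), the skew side.**  If the three numbers `ε_k p_k + ε_i p_i` of the sign vector `ε = cubeInt c`
are non-integers (`p = √2 · cubicCoords τ`), every slot OFF the plane `ε^⊥` is skew for `τ`. -/
theorem skew_of_offPlane (τ : EuclideanSpace ℝ (Fin 3)) (c : Fin 8)
    (hc : ∀ k i : Fin 3, k ≠ i → ¬ ∃ z : ℤ,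
      (cubeInt c k : ℝ) * (Real.sqrt 2 * cubicCoords τ k) + (cubeInt c i : ℝ) * (Real.sqrt 2 * cubicCoords τ i) = z)
    (m : Fin 12) (hm : cubeInt c ⬝ᵥ slotInt m ≠ 0) : ∀ z : ℤ, ⟪τ, slotSite m⟫_ℝ ≠ (z : ℝ) / 2 := by
  intro z hz
  obtain ⟨k, i, hki, hshape, h0⟩ := slotInt_offPlane_shape c m hm
  have h2 : ∑ j, (slotInt m j : ℝ) * (Real.sqrt 2 * cubicCoords τ j) = z := by
    rw [← two_inner_slotSite, hz]; ring
  rw [sum_fin_three_of_support _ k i hki (fun j hj hj' => by rw [h0 j hj hj']; simp)] at h2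
  rcases hshape with ⟨e, e'⟩ | ⟨e, e'⟩ <;> rw [e, e'] at h2 <;> push_cast at h2
  · exact hc k i hki ⟨z, by linarith⟩
  · exact hc k i hki ⟨-z, by push_cast; linarith⟩

/-- **The basal axis in cubic coordinates:** `cubicCoords e₃ = (−1, 1, 1)/√3 = cubeInt 4 / √3`. -/
theorem cubicCoords_e₃ (i : Fin 3) :
    cubicCoords (EuclideanSpace.single (2 : Fin 3) (1 : ℝ)) i = (cubeInt 4 i : ℝ) / Real.sqrt 3 := by
  have hs0 : Real.sqrt 2 ≠ 0 := by positivity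
  have h30 : Real.sqrt 3 ≠ 0 := by positivity
  fin_cases i <;> simp [cubicCoords, cubeInt] <;> field_simp

/-- **A bond mirror on the basal axis, in cubic coordinates:**
`cubicCoords (r_m e₃) = (n − (n ⬝ s) s)/√3` with `n = cubeInt 4`, `s = slotInt m`. -/
theorem cubicCoords_bondMirror_e₃ (m : Fin 12) (i : Fin 3) :
    cubicCoords ((ℝ ∙ slotSite m)ᗮ.reflection (EuclideanSpace.single (2 : Fin 3) (1 : ℝ))) i =
      ((cubeInt 4 i : ℝ) - ((cubeInt 4 ⬝ᵥ slotInt m : ℤ) : ℝ) * slotInt m i) / Real.sqrt 3 := by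
  have hw : ‖slotSite m‖ = 1 := norm_eq_one_of_mem_fccSlots (slotSite_mem m)
  have hs : Real.sqrt 2 ^ 2 = 2 := Real.sq_sqrt (by norm_num)
  have hs0 : Real.sqrt 2 ≠ 0 := by positivity
  have h30 : Real.sqrt 3 ≠ 0 := by positivity
  have hinner : ⟪slotSite m, EuclideanSpace.single (2 : Fin 3) (1 : ℝ)⟫_ℝ =
      ∑ j, slotVec m j * ((cubeInt 4 j : ℝ) / Real.sqrt 3) := by
    rw [inner_eq_cubicCoords, cubicCoords_slotSite]
    simp only [dotProduct]
    exact Finset.sum_congr rfl fun j _ => by rw [cubicCoords_e₃]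
  rw [bondReflection_apply _ _ hw, cubicCoords_sub, cubicCoords_smul, cubicCoords_slotSite, hinner]
  simp only [Pi.sub_apply, Pi.smul_apply, smul_eq_mul, cubicCoords_e₃, dotProduct, Fin.sum_univ_three, slotVec]
  push_cast
  field_simp
  rw [hs]; ring

/-- The image of `Λ₀` under a bond mirror of a slot is `Λ₀`. -/
theorem bondMirror_image_fcc (m : Fin 12) :
    (ℝ ∙ slotSite m)ᗮ.reflection '' fccStacking 1 (Real.sqrt (2 / 3)) = fccStacking 1 (Real.sqrt (2 / 3)) := by
  have h := latticeIsometry_bondReflection (mem_fcc_of_mem_fccSlots (slotSite_mem m))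
    (norm_eq_one_of_mem_fccSlots (slotSite_mem m))
  refine Set.Subset.antisymm ?_ ?_
  · rintro _ ⟨p, hp, rfl⟩; exact h.1 p hp
  · intro p hp
    exact ⟨((ℝ ∙ slotSite m)ᗮ.reflection).symm p, h.2 p hp, LinearIsometryEquiv.apply_symm_apply _ p⟩

/-- Table: the four `{111}` normals `±cubeInt c` are the basal axis `cubeInt 4` or its image under the bond
mirror of slot `8`, `2` or `6`. -/
theorem cubeInt_frame_table : ∀ c : Fin 8,
    (∀ i : Fin 3, cubeInt 4 i = cubeInt c i) ∨ (∀ i : Fin 3, cubeInt 4 i = -cubeInt c i) ∨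
    ∃ m : Fin 12, (∀ i : Fin 3, cubeInt 4 i - (cubeInt 4 ⬝ᵥ slotInt m) * slotInt m i = cubeInt c i) ∨
      (∀ i : Fin 3, cubeInt 4 i - (cubeInt 4 ⬝ᵥ slotInt m) * slotInt m i = -cubeInt c i) := by
  decide

/-- **The lattice frame of a cube vertex.**  For every `c` there is a symmetry `G` of `Λ₀` (`G·Λ₀ = Λ₀`)
whose image of the basal axis has cubic coordinates proportional to `cubeInt c`. -/
theorem exists_latticeFrame_of_cube (c : Fin 8) :
    ∃ G : EuclideanSpace ℝ (Fin 3) ≃ₗᵢ[ℝ] EuclideanSpace ℝ (Fin 3),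
      G '' fccStacking 1 (Real.sqrt (2 / 3)) = fccStacking 1 (Real.sqrt (2 / 3)) ∧
      ∃ κ : ℝ, κ ≠ 0 ∧ ∀ i : Fin 3,
        cubicCoords (G (EuclideanSpace.single (2 : Fin 3) (1 : ℝ))) i = κ * cubeInt c i := by
  have h30 : (1 : ℝ) / Real.sqrt 3 ≠ 0 := by positivity
  rcases cubeInt_frame_table c with h | h | ⟨m, h | h⟩
  · refine ⟨LinearIsometryEquiv.refl ℝ _, by simp, 1 / Real.sqrt 3, h30, fun i => ?_⟩
    rw [LinearIsometryEquiv.coe_refl, id, cubicCoords_e₃, ← h i]; ring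
  · refine ⟨LinearIsometryEquiv.refl ℝ _, by simp, -(1 / Real.sqrt 3), neg_ne_zero.2 h30, fun i => ?_⟩
    rw [LinearIsometryEquiv.coe_refl, id, cubicCoords_e₃, h i]; push_cast; ring
  · refine ⟨(ℝ ∙ slotSite m)ᗮ.reflection, bondMirror_image_fcc m, 1 / Real.sqrt 3, h30, fun i => ?_⟩
    rw [cubicCoords_bondMirror_e₃, ← h i]; push_cast; ring
  · refine ⟨(ℝ ∙ slotSite m)ᗮ.reflection, bondMirror_image_fcc m, -(1 / Real.sqrt 3), neg_ne_zero.2 h30,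
      fun i => ?_⟩
    have h' : (cubeInt c i : ℝ) = -((cubeInt 4 i : ℝ) - ((cubeInt 4 ⬝ᵥ slotInt m : ℤ) : ℝ) * slotInt m i) := by
      have := h i; rw [eq_neg_iff_add_eq_zero] at this ⊢
      exact_mod_cast (by linarith : (cubeInt c i : ℤ) + (cubeInt 4 i - (cubeInt 4 ⬝ᵥ slotInt m) * slotInt m i) = 0)
    rw [cubicCoords_bondMirror_e₃, h']; ring

/-- **Case (C).**  If the three numbers `ε_k p_k + ε_i p_i` (`ε = cubeInt c`, `p = √2·cubicCoords τ`) are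
non-integers, then for every orientation `A₁` there is a frame `L'` of the SAME lattice (`L'·Λ₀ = A₁·Λ₀`) for
which every slot off the `L' e₃`-plane is τ-skew (the hypothesis `hskew` of
`coaxialTwoSlabAdhesion_general_trans_net`). -/
theorem exists_skewFrame_of_cube (A₁ : EuclideanSpace ℝ (Fin 3) ≃ₗᵢ[ℝ] EuclideanSpace ℝ (Fin 3))
    (τ : EuclideanSpace ℝ (Fin 3)) (c : Fin 8)
    (hc : ∀ k i : Fin 3, k ≠ i → ¬ ∃ z : ℤ,
      (cubeInt c k : ℝ) * (Real.sqrt 2 * cubicCoords τ k) + (cubeInt c i : ℝ) * (Real.sqrt 2 * cubicCoords τ i) = z) :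
    ∃ L' : EuclideanSpace ℝ (Fin 3) ≃ₗᵢ[ℝ] EuclideanSpace ℝ (Fin 3),
      L' '' fccStacking 1 (Real.sqrt (2 / 3)) = A₁ '' fccStacking 1 (Real.sqrt (2 / 3)) ∧
      ∀ s ∈ fccSlots, ⟪A₁ s, L' (EuclideanSpace.single (2 : Fin 3) (1 : ℝ))⟫_ℝ ≠ 0 →
        ∀ z : ℤ, ⟪τ, s⟫_ℝ ≠ (z : ℝ) / 2 := by
  obtain ⟨G, hG, κ, hκ, hcoord⟩ := exists_latticeFrame_of_cube c
  refine ⟨G.trans A₁, ?_, ?_⟩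
  · rw [LinearIsometryEquiv.coe_trans, Set.image_comp, hG]
  · intro s hs hne
    obtain ⟨m, rfl⟩ := exists_slotSite_eq hs
    apply skew_of_offPlane τ c hc m
    intro h0
    apply hne
    rw [LinearIsometryEquiv.trans_apply, A₁.inner_map_map, inner_eq_cubicCoords, cubicCoords_slotSite]
    have : cubicCoords (G (EuclideanSpace.single (2 : Fin 3) (1 : ℝ))) = fun i => κ * cubeInt c i :=
      funext hcoord
    rw [this]
    have h0' : ((cubeInt c ⬝ᵥ slotInt m : ℤ) : ℝ) = 0 := by rw [h0]; simp
    simp only [dotProduct, Fin.sum_univ_three] at h0' ⊢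
    simp only [slotVec]
    push_cast at h0'
    have : (slotInt m 0 : ℝ) / Real.sqrt 2 * (κ * cubeInt c 0) + (slotInt m 1 : ℝ) / Real.sqrt 2 * (κ * cubeInt c 1) +
        (slotInt m 2 : ℝ) / Real.sqrt 2 * (κ * cubeInt c 2) =
        κ / Real.sqrt 2 * ((cubeInt c 0 : ℝ) * slotInt m 0 + cubeInt c 1 * slotInt m 1 + cubeInt c 2 * slotInt m 2) := by
      ring
    rw [this, h0', mul_zero]

end Summit.Ventures.Crystal3D.Theorems

end
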